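import Literature.Topology.FourManifolds.TautFoliationsGermCovering
import Mathlib.Topology.Homotopy.Lifting
import Mathlib.Topology.Germ
import HarnessLib

/-!
# Leaf holonomy of a `C⁰` codimension-one foliation: continuation of distinguished maps

Sibling of `TautFoliationsGermCovering.lean`, which packages the germinal holonomy of a `C⁰`
codimension-one foliation `F : Literature.Topology.FourManifolds.Foliation B M` as the covering map
`GermSpace.proj : F.GermSpace → F.LeafSpace` of the leaf space by the distinguished germs (germs
of local first integrals). This file reads **leaf holonomy** off that covering (Hector–Hirsch,
*Introduction to the Geometry of Foliations, Part A*, Ch. III 2.1.4–2.1.7 and 2.2.1: the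
holonomy representation of a leaf, obtained by composing the transition germs `γᵢⱼ` along a
chain of plaques covering a leaf path and depending only on its homotopy class; Camacho–Lins
Neto, *Geometric Theory of Foliations*, Ch. IV §1, Thm. 1 and §2):

* `GermSpace.ofHeight he q hq` (**definition**): the germ at `q` of the distinguished map
  `h_e` of a flow box `e ∋ q`, the base point of the continuation; `GermSpace.level d`
  (**definition**): the value at the base point of a distinguished germ, a *locally constant*
  function on the germ space (`isLocallyConstant_level`), hence constant along lifts.
* `continuation he₀ hp γ` (**definition**): the **continuation of the distinguished map
  `h_{e₀}` along the homotopy class `γ` of leaf paths from `p` to `q`** — the end point of the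
  lift of `γ` to the germ space starting at the germ of `h_{e₀}` at `p` (Mathlib's
  `IsCoveringMap.monodromy`); a distinguished germ at `q` (`continuation_pt`) of level
  `h_{e₀}(p)` (`level_continuation`).
* `holonomyGerm he₀ hp γ he₁ hq` (**definition**): the **holonomy germ** of `γ` read in the
  boxes `e₀ ∋ p`, `e₁ ∋ q`: the homeomorphism germ `ψ` at `h_{e₁}(q)` with
  `continuation = ψ ∘ h_{e₁}` near `q` (`exists_isHomeoGermAt_holonomyGerm_eq`,
  `writeGerm_holonomyGerm`); `ψ` carries `e₁`-heights of the local leaves near `q` to the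
  `e₀`-heights near `p` of the same leaves followed back along `γ` (the inverse of the
  classical holonomy map `h_γ` between the transversals). By construction it **depends only
  on the homotopy class of the leaf path** (the monodromy theorem;
  `holonomyGerm_mk_eq_of_homotopic`).
* **Computations**: the holonomy of the constant path is the transition germ `γ_{e₁ e₀}`
  (`holonomyGerm_refl`), the identity when `e₁ = e₀` (`holonomyGerm_refl_self`); a leaf path
  running in a single plaque of `e` has trivial holonomy read in `e`
  (`holonomyGerm_mk_eq_id_of_forall_mem_plaque`, with the explicit lift
  `continuation_mk_eq_of_forall_mem_plaque`); **null-homotopic leaf loops have trivial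
  holonomy** (`holonomyGerm_mk_eq_id_of_homotopic_refl`), in particular every leaf loop of a
  leaf that is simply connected in its leaf topology
  (`holonomyGerm_eq_id_of_simplyConnectedSpace`; Hector–Hirsch A, Ch. III 2.1.7 (ii):
  simply connected leaves have trivial holonomy).
* **Continuous families of first integrals over simply connected domains**
  (`existsUnique_lift_of_simplyConnectedSpace`): a continuous map `g : A → M^δ` from a
  simply connected, locally path connected space (a disc, a sphere) lifts uniquely to the
  germ space with prescribed germ `h_e` at one point — Mathlib's lifting criterion
  `IsCoveringMap.existsUnique_continuousMap_lifts`. This is the form in which "the holonomy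
  of `F` along `g` is trivial" enters the Reeb stability theorem and Novikov's theorem
  (Camacho–Lins Neto, Ch. IV §2–§4; Ch. VII).

## References

* G. Hector, U. Hirsch, *Introduction to the Geometry of Foliations, Part A*, 2nd ed., Vieweg
  (1986), Ch. III 2.1.4–2.1.7, 2.2.1 [HectorHirsch1986].
* C. Camacho, A. Lins Neto, *Geometric Theory of Foliations*, Birkhäuser (1985), Ch. IV §1–§2
  [CamachoLinsNeto1985].
* A. Hatcher, *Algebraic Topology*, CUP (2002), Prop. 1.30, Prop. 1.33 (lifting)
  [HatcherAT2002].

## Design notes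

* Holonomy is defined on homotopy classes `Path.Homotopic.Quotient p q` of paths in the leaf
  space `F.LeafSpace` (leaf topology), through `IsCoveringMap.monodromy` of the germ
  covering; statements for individual paths use `Path.Homotopic.Quotient.mk`.
* The holonomy germ is an element of `Filter.Germ (𝓝 (h_{e₁} q)) ℝ`; representatives `ψ` with
  `IsHomeoGermAt ψ _` are provided by `exists_isHomeoGermAt_holonomyGerm_eq`.
* `B` nonempty and locally connected (for the covering structure); no smoothness.
-/
open scoped Topology unitInterval
open Function Set Filter Topology

namespace Literature.Topology.FourManifolds

namespace Foliation

variable {B : Type*} [TopologicalSpace B] {M : Type*} [TopologicalSpace M]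
variable {e e₀ e₁ : OpenPartialHomeomorph M (B × ℝ)} {t : ℝ} {z : M}
variable (F : Foliation B M)

-- BODY
/-! ## Germs of distinguished maps as base points; the level of a distinguished germ -/

namespace GermSpace

/-- The germ at `q` of the distinguished map `h_e` of a flow box `e ∋ q` of the atlas, as a
point of the germ space over `q`: the starting point of continuations. [folklore] -/
def ofHeight (he : e ∈ F.atlas) (q : F.LeafSpace) (hq : ofLeafSpace q ∈ e.source) : F.GermSpace :=
  ⟨q, ↑(height e), F.isDistinguishedGerm_height he hq⟩

/-- The base point of `ofHeight`. [folklore] -/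
@[simp] theorem ofHeight_pt (he : e ∈ F.atlas) (q : F.LeafSpace) (hq : ofLeafSpace q ∈ e.source) :
    (ofHeight F he q hq).pt = q := rfl

/-- The germ of `ofHeight`. [folklore] -/
@[simp] theorem ofHeight_germ (he : e ∈ F.atlas) (q : F.LeafSpace) (hq : ofLeafSpace q ∈ e.source) :
    (ofHeight F he q hq).germ = ↑(height e) := rfl

/-- The projection of `ofHeight`. [folklore] -/
@[simp] theorem proj_ofHeight (he : e ∈ F.atlas) (q : F.LeafSpace) (hq : ofLeafSpace q ∈ e.source) :
    (ofHeight F he q hq).proj = q := rfl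

/-- `ofHeight` as a point of the fibre of the germ space over `q`. [folklore] -/
def ofHeightFiber (he : e ∈ F.atlas) (q : F.LeafSpace) (hq : ofLeafSpace q ∈ e.source) :
    (proj ⁻¹' {q} : Set F.GermSpace) :=
  ⟨ofHeight F he q hq, rfl⟩

/-- The underlying point of `ofHeightFiber`. [folklore] -/
@[simp] theorem coe_ofHeightFiber (he : e ∈ F.atlas) (q : F.LeafSpace)
    (hq : ofLeafSpace q ∈ e.source) :
    (ofHeightFiber F he q hq : F.GermSpace) = ofHeight F he q hq := rfl

variable {F}

/-- The **level** of a distinguished germ: its value at its base point (the value of the local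
first integral on the leaf through the base point). [folklore] -/
def level (d : F.GermSpace) : ℝ := d.germ.value

/-- The level of a section `germ (φ ∘ h_e)` along the plaque of `e` at height `t` is `φ t`.
[folklore] -/
@[simp] theorem level_germSection (he : e ∈ F.atlas) (t : ℝ) {φ : ℝ → ℝ} (hφ : IsHomeoGermAt φ t)
    (b : B) : level (F.germSection he t hφ b) = φ t := by
  show Germ.value (↑(φ ∘ height e) : Germ (𝓝 (ofLeafSpace (F.leafPlaqueMap e t b))) ℝ) = φ t
  rw [Germ.value_ofFun, comp_apply, height_apply, ofLeafSpace_leafPlaqueMap, F.apply_plaqueMap he]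

/-- The level of the germ of `h_e` at `q` is `h_e(q)`. [folklore] -/
@[simp] theorem level_ofHeight (he : e ∈ F.atlas) (q : F.LeafSpace) (hq : ofLeafSpace q ∈ e.source) :
    level (ofHeight F he q hq) = (e (ofLeafSpace q)).2 := rfl

/-- **The level is locally constant on the germ space** (along every section it is constant).
[folklore] -/
theorem isLocallyConstant_level : IsLocallyConstant (level : F.GermSpace → ℝ) := by
  refine IsLocallyConstant.iff_isOpen_fiber.2 fun r ↦ GermSpace.isOpen_iff.2 fun e he t φ hφ ↦ ?_
  by_cases h : φ t = r
  · have : F.germSection he t hφ ⁻¹' (level ⁻¹' {r}) = univ :=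
      eq_univ_of_forall fun b ↦ by simp [h]
    rw [this]
    exact isOpen_univ
  · have : F.germSection he t hφ ⁻¹' (level ⁻¹' {r}) = ∅ :=
      eq_empty_of_forall_notMem fun b hb ↦ h (by simpa using hb)
    rw [this]
    exact isOpen_empty

/-- **The level is constant along paths in the germ space.** [folklore] -/
theorem level_apply_eq_of_path (Γ : C(I, F.GermSpace)) (s s' : I) : level (Γ s) = level (Γ s') :=
  (isLocallyConstant_level.comp_continuous Γ.continuous).apply_eq_of_preconnectedSpace s s'

end GermSpace

/-! ## The plaque lift of a leaf path in one plaque -/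

section PlaqueLift

variable {p q : F.LeafSpace}

/-- The explicit lift to the germ space of a leaf path running in the plaque of `e` at height
`t`: the germ of `h_e` at each of its points (the section `germSection he t id` along the
`B`-coordinate of the path). [folklore] -/
noncomputable def plaqueLift (he : e ∈ F.atlas) (γ : Path p q)
    (hγ : ∀ s, ofLeafSpace (γ s) ∈ plaque e t) : C(I, F.GermSpace) where
  toFun s := F.germSection he t (IsHomeoGermAt.id t) (e (ofLeafSpace (γ s))).1
  continuous_toFun := (F.continuous_germSection he t _).comp (continuous_fst.comp
    (e.continuousOn.comp_continuous (F.continuous_ofLeafSpace.comp γ.continuous)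
      fun s ↦ (hγ s).1))

/-- The plaque lift lies over the path. [folklore] -/
theorem proj_plaqueLift (he : e ∈ F.atlas) (γ : Path p q) (hγ : ∀ s, ofLeafSpace (γ s) ∈ plaque e t)
    (s : I) : (F.plaqueLift he γ hγ s).proj = γ s :=
  (ofLeafSpace (F := F)).injective (plaqueMap_fst_eq (hγ s))

/-- The plaque lift at each parameter is the germ of `h_e` at the point of the path.
[folklore] -/
theorem plaqueLift_apply (he : e ∈ F.atlas) (γ : Path p q) (hγ : ∀ s, ofLeafSpace (γ s) ∈ plaque e t)
    (s : I) : F.plaqueLift he γ hγ s = GermSpace.ofHeight F he (γ s) (hγ s).1 := by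
  refine GermSpace.ext_heq (F.proj_plaqueLift he γ hγ s) ?_
  show HEq ((↑(id ∘ height e)) : Germ (𝓝 (ofLeafSpace (F.leafPlaqueMap e t (e (ofLeafSpace (γ s))).1))) ℝ)
    ((↑(height e)) : Germ (𝓝 (ofLeafSpace (γ s))) ℝ)
  rw [id_comp]
  exact GermSpace.coe_germ_heq (congrArg ofLeafSpace (F.proj_plaqueLift he γ hγ s)) (height e)

/-- **The level of a continuous family of germs is constant on a preconnected domain**: all
the germs `G a` of a continuous family over a preconnected `A` have the same level (the first
integrals take one and the same value on the leaf of `g`). [folklore] -/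
theorem level_apply_eq_of_preconnectedSpace {A : Type*} [TopologicalSpace A] [PreconnectedSpace A]
    (G : C(A, F.GermSpace)) (a a' : A) : GermSpace.level (G a) = GermSpace.level (G a') :=
  (GermSpace.isLocallyConstant_level.comp_continuous G.continuous).apply_eq_of_preconnectedSpace a a'

end PlaqueLift

/-! ## Continuation of distinguished maps along leaf paths; the holonomy germ -/

section Holonomy

variable [Nonempty B] [LocallyConnectedSpace B]
variable {p q : F.LeafSpace}

/-- **Continuation of a distinguished map along a leaf path.** For a flow box `e₀ ∋ p` of the
atlas and a homotopy class `γ` of paths from `p` to `q` in the leaf space, the end point of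
the lift of `γ` to the germ space starting at the germ of `h_{e₀}` at `p` — the germ at `q`
of the local first integral obtained by continuing `h_{e₀}` along `γ` (Camacho–Lins Neto,
Ch. IV §1: the holonomy of a path as the germ of the composite of the local projections
along a chain of plaques; here through Mathlib's `IsCoveringMap.monodromy` of the germ
covering). [cite: CamachoLinsNeto1985, Ch. IV §1] -/
noncomputable def continuation (he₀ : e₀ ∈ F.atlas) (hp : ofLeafSpace p ∈ e₀.source)
    (γ : Path.Homotopic.Quotient p q) : F.GermSpace :=
  ((F.isCoveringMap_proj).monodromy γ (GermSpace.ofHeightFiber F he₀ p hp) : F.GermSpace)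

/-- The continuation along `γ` is a germ at the end point of `γ`. [folklore] -/
@[simp] theorem continuation_pt (he₀ : e₀ ∈ F.atlas) (hp : ofLeafSpace p ∈ e₀.source)
    (γ : Path.Homotopic.Quotient p q) : (F.continuation he₀ hp γ).pt = q :=
  ((F.isCoveringMap_proj).monodromy γ (GermSpace.ofHeightFiber F he₀ p hp)).2

/-- The continuation along (the class of) a path is the end point of its lift. [folklore] -/
theorem continuation_mk (he₀ : e₀ ∈ F.atlas) (hp : ofLeafSpace p ∈ e₀.source) (γ : Path p q) :
    F.continuation he₀ hp (Path.Homotopic.Quotient.mk γ) =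
      (F.isCoveringMap_proj).liftPath γ (GermSpace.ofHeight F he₀ p hp) γ.source 1 :=
  rfl

/-- **The continuation along the constant path is the germ of `h_{e₀}` itself.** [folklore] -/
@[simp] theorem continuation_refl (he₀ : e₀ ∈ F.atlas) (hp : ofLeafSpace p ∈ e₀.source) :
    F.continuation he₀ hp (Path.Homotopic.Quotient.refl p) = GermSpace.ofHeight F he₀ p hp :=
  congrArg Subtype.val (congr_fun (F.isCoveringMap_proj).monodromy_refl
    (GermSpace.ofHeightFiber F he₀ p hp))

/-- **The level of a continuation is the initial height**: the continued first integral takes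
the value `h_{e₀}(p)` on the leaf of the path (the level is constant along the lift).
[folklore] -/
@[simp] theorem level_continuation (he₀ : e₀ ∈ F.atlas) (hp : ofLeafSpace p ∈ e₀.source)
    (γ : Path.Homotopic.Quotient p q) :
    GermSpace.level (F.continuation he₀ hp γ) = (e₀ (ofLeafSpace p)).2 := by
  induction γ using Path.Homotopic.Quotient.ind with
  | mk γ =>
    rw [continuation_mk]
    have h := GermSpace.level_apply_eq_of_path
      ((F.isCoveringMap_proj).liftPath γ (GermSpace.ofHeight F he₀ p hp) γ.source) 1 0
    rwa [(F.isCoveringMap_proj).liftPath_zero, GermSpace.level_ofHeight] at h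

/-- The base point of the continuation lies on the plaque of `e₁` through `q`, for a flow box
`e₁ ∋ q`. [folklore] -/
theorem continuation_mem_plaque (he₀ : e₀ ∈ F.atlas) (hp : ofLeafSpace p ∈ e₀.source)
    (γ : Path.Homotopic.Quotient p q) (hq : ofLeafSpace q ∈ e₁.source) :
    ofLeafSpace (F.continuation he₀ hp γ).pt ∈ plaque e₁ (e₁ (ofLeafSpace q)).2 := by
  rw [continuation_pt]
  exact mem_plaque_self hq

/-- **The holonomy germ of a leaf path** `γ` from `p` to `q`, read in the flow boxes `e₀ ∋ p`
and `e₁ ∋ q` of the atlas: the germ `ψ` at `h_{e₁}(q)` such that the continuation of `h_{e₀}`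
along `γ` is `ψ ∘ h_{e₁}` near `q` (`writeGerm_holonomyGerm`). It is a homeomorphism germ
taking `h_{e₁}(q)` to `h_{e₀}(p)` (`exists_isHomeoGermAt_holonomyGerm_eq`) and carries the
`e₁`-height of a local leaf near `q` to the `e₀`-height near `p` of its continuation back
along `γ` — the inverse of the holonomy map `h_γ` between the transversals of `e₀` at `p` and
of `e₁` at `q` (Hector–Hirsch A, Ch. III 2.1.4–2.1.6, 2.2.1; Camacho–Lins Neto, Ch. IV §1).
It depends only on the homotopy class of `γ`. [cite: HectorHirsch1986, Ch. III 2.2.1] -/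
noncomputable def holonomyGerm (he₀ : e₀ ∈ F.atlas) (hp : ofLeafSpace p ∈ e₀.source)
    (γ : Path.Homotopic.Quotient p q) (he₁ : e₁ ∈ F.atlas) (hq : ofLeafSpace q ∈ e₁.source) :
    Germ (𝓝 (e₁ (ofLeafSpace q)).2) ℝ :=
  F.readGerm he₁ (F.continuation_mem_plaque he₀ hp γ hq) (F.continuation he₀ hp γ).germ

/-- **The continuation is the holonomy germ composed with the distinguished map**:
`continuation = ψ ∘ h_{e₁}` near `q`. [folklore] -/
theorem writeGerm_holonomyGerm (he₀ : e₀ ∈ F.atlas) (hp : ofLeafSpace p ∈ e₀.source)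
    (γ : Path.Homotopic.Quotient p q) (he₁ : e₁ ∈ F.atlas) (hq : ofLeafSpace q ∈ e₁.source) :
    writeGerm (F.continuation_mem_plaque he₀ hp γ hq) (F.holonomyGerm he₀ hp γ he₁ hq) =
      (F.continuation he₀ hp γ).germ :=
  F.writeGerm_readGerm he₁ _ (F.continuation he₀ hp γ).isDist

/-- **The holonomy germ is a homeomorphism germ taking `h_{e₁}(q)` to `h_{e₀}(p)`.**
[folklore] -/
theorem exists_isHomeoGermAt_holonomyGerm_eq (he₀ : e₀ ∈ F.atlas) (hp : ofLeafSpace p ∈ e₀.source)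
    (γ : Path.Homotopic.Quotient p q) (he₁ : e₁ ∈ F.atlas) (hq : ofLeafSpace q ∈ e₁.source) :
    ∃ ψ : ℝ → ℝ, IsHomeoGermAt ψ (e₁ (ofLeafSpace q)).2 ∧ F.holonomyGerm he₀ hp γ he₁ hq = ↑ψ ∧
      ψ (e₁ (ofLeafSpace q)).2 = (e₀ (ofLeafSpace p)).2 := by
  obtain ⟨ψ, hψ, hψe⟩ := F.exists_readGerm_eq he₁ (F.continuation_mem_plaque he₀ hp γ hq)
    (F.continuation he₀ hp γ).isDist
  refine ⟨ψ, hψ, hψe, ?_⟩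
  -- the level of the continuation, computed from `continuation = ψ ∘ h_{e₁}`
  have hlev := F.level_continuation he₀ hp γ
  have hw : writeGerm (F.continuation_mem_plaque he₀ hp γ hq) (↑ψ : Germ _ ℝ) =
      (F.continuation he₀ hp γ).germ := by
    rw [← hψe]
    exact F.writeGerm_holonomyGerm he₀ hp γ he₁ hq
  rw [writeGerm_coe] at hw
  unfold GermSpace.level at hlev
  rw [← hw, Germ.value_ofFun, comp_apply, height_apply] at hlev
  have hpt : (e₁ (ofLeafSpace (F.continuation he₀ hp γ).pt)).2 = (e₁ (ofLeafSpace q)).2 := by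
    rw [continuation_pt]
  rwa [hpt] at hlev

/-- **The holonomy of the constant path is the transition germ** `γ_{e₁ e₀}` at `p` (reading
`h_{e₀}` through the vertical of `e₁`). [folklore] -/
theorem holonomyGerm_refl (he₀ : e₀ ∈ F.atlas) (hp : ofLeafSpace p ∈ e₀.source) (he₁ : e₁ ∈ F.atlas)
    (hp₁ : ofLeafSpace p ∈ e₁.source) :
    F.holonomyGerm he₀ hp (Path.Homotopic.Quotient.refl p) he₁ hp₁ =
      ↑(transition e₁ e₀ (ofLeafSpace p)) := by
  suffices H : ∀ (d : F.GermSpace) (_ : d = GermSpace.ofHeight F he₀ p hp)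
      (hz : ofLeafSpace d.pt ∈ plaque e₁ (e₁ (ofLeafSpace p)).2),
      F.readGerm he₁ hz d.germ = ↑(transition e₁ e₀ (ofLeafSpace p)) from
    H _ (F.continuation_refl he₀ hp) _
  rintro d rfl hz
  exact F.readGerm_coe he₁ hz (height e₀)

/-- **The holonomy of the constant path, read in one box, is the identity.** [folklore] -/
theorem holonomyGerm_refl_self (he₀ : e₀ ∈ F.atlas) (hp : ofLeafSpace p ∈ e₀.source) :
    F.holonomyGerm he₀ hp (Path.Homotopic.Quotient.refl p) he₀ hp = ↑(id : ℝ → ℝ) := by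
  rw [holonomyGerm_refl, F.transition_self he₀]

/-- **Homotopic leaf paths have the same holonomy** (the monodromy theorem for the germ
covering; Hector–Hirsch A, Ch. III 2.1.5; Camacho–Lins Neto, Ch. IV §1, Lemma 2).
[cite: HectorHirsch1986, Ch. III 2.1.5] -/
theorem holonomyGerm_mk_eq_of_homotopic (he₀ : e₀ ∈ F.atlas) (hp : ofLeafSpace p ∈ e₀.source)
    {γ γ' : Path p q} (h : γ.Homotopic γ') (he₁ : e₁ ∈ F.atlas) (hq : ofLeafSpace q ∈ e₁.source) :
    F.holonomyGerm he₀ hp (Path.Homotopic.Quotient.mk γ) he₁ hq =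
      F.holonomyGerm he₀ hp (Path.Homotopic.Quotient.mk γ') he₁ hq := by
  rw [Path.Homotopic.Quotient.eq.2 h]

/-- **Null-homotopic leaf loops have trivial holonomy.** [folklore] -/
theorem holonomyGerm_mk_eq_id_of_homotopic_refl (he₀ : e₀ ∈ F.atlas) (hp : ofLeafSpace p ∈ e₀.source)
    {γ : Path p p} (h : γ.Homotopic (Path.refl p)) :
    F.holonomyGerm he₀ hp (Path.Homotopic.Quotient.mk γ) he₀ hp = ↑(id : ℝ → ℝ) := by
  rw [F.holonomyGerm_mk_eq_of_homotopic he₀ hp h he₀ hp, Path.Homotopic.Quotient.mk_refl,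
    holonomyGerm_refl_self]

/-- **Leaves that are simply connected in their leaf topology have trivial holonomy**: every
leaf loop at `p` in such a leaf has the identity as holonomy germ (Hector–Hirsch A, Ch. III
2.1.7 (ii); Camacho–Lins Neto, Ch. IV §1, Cor.). [cite: HectorHirsch1986, Ch. III 2.1.7] -/
theorem holonomyGerm_eq_id_of_simplyConnectedSpace {x : M} [SimplyConnectedSpace (F.Leaf x)]
    {p : F.Leaf x} (he₀ : e₀ ∈ F.atlas) (hp : ofLeafSpace (p : F.LeafSpace) ∈ e₀.source)
    (γ : Path p p) :
    F.holonomyGerm he₀ hp (Path.Homotopic.Quotient.mk (γ.map continuous_subtype_val)) he₀ hp =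
      ↑(id : ℝ → ℝ) := by
  have h : γ.Homotopic (Path.refl p) := SimplyConnectedSpace.paths_homotopic γ (Path.refl p)
  have h' : (γ.map continuous_subtype_val).Homotopic ((Path.refl p).map continuous_subtype_val) :=
    h.map ⟨Subtype.val, continuous_subtype_val⟩
  exact F.holonomyGerm_mk_eq_id_of_homotopic_refl he₀ hp h'

/-! ## Leaf paths in a single plaque -/

/-- **A leaf path in a single plaque continues `h_e` to itself**: its lift to the germ space
from the germ of `h_e` is the plaque lift, so the continuation of `h_e` along it is the germ
of `h_e` at the end point (`hp`, `hq`, implied by `hγ`, fix the base germs). [folklore] -/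
theorem continuation_mk_eq_of_forall_mem_plaque (he : e ∈ F.atlas) (γ : Path p q)
    (hγ : ∀ s, ofLeafSpace (γ s) ∈ plaque e t) (hp : ofLeafSpace p ∈ e.source)
    (hq : ofLeafSpace q ∈ e.source) :
    F.continuation he hp (Path.Homotopic.Quotient.mk γ) = GermSpace.ofHeight F he q hq := by
  -- the plaque lift is the lift of `γ` from the germ of `h_e` at `p`
  have hlift : F.plaqueLift he γ hγ =
      (F.isCoveringMap_proj).liftPath γ (GermSpace.ofHeight F he p hp) γ.source := by
    rw [(F.isCoveringMap_proj).eq_liftPath_iff']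
    refine ⟨funext fun s ↦ F.proj_plaqueLift he γ hγ s, ?_⟩
    rw [F.plaqueLift_apply he γ hγ 0]
    exact GermSpace.ext_heq γ.source (GermSpace.coe_germ_heq (congrArg ofLeafSpace γ.source) _)
  rw [continuation_mk, ← hlift, F.plaqueLift_apply he γ hγ 1]
  exact GermSpace.ext_heq γ.target (GermSpace.coe_germ_heq (congrArg ofLeafSpace γ.target) _)

/-- **A leaf path in a single plaque of `e` has trivial holonomy read in `e`.** [folklore] -/
theorem holonomyGerm_mk_eq_id_of_forall_mem_plaque (he : e ∈ F.atlas) (γ : Path p q)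
    (hγ : ∀ s, ofLeafSpace (γ s) ∈ plaque e t) (hp : ofLeafSpace p ∈ e.source)
    (hq : ofLeafSpace q ∈ e.source) :
    F.holonomyGerm he hp (Path.Homotopic.Quotient.mk γ) he hq = ↑(id : ℝ → ℝ) := by
  suffices H : ∀ (d : F.GermSpace) (_ : d = GermSpace.ofHeight F he q hq)
      (hz : ofLeafSpace d.pt ∈ plaque e (e (ofLeafSpace q)).2),
      F.readGerm he hz d.germ = ↑(id : ℝ → ℝ) from
    H _ (F.continuation_mk_eq_of_forall_mem_plaque he γ hγ hp hq) _
  rintro d rfl hz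
  exact (F.readGerm_coe he hz (height e)).trans (by rw [F.height_comp_vertical he])

/-! ## Continuous families of first integrals over simply connected domains -/

/-- **Lifting over simply connected domains** (the lifting criterion for the germ covering):
a continuous map `g` from a simply connected, locally path connected space `A` into the leaf
space (hence into one leaf), a point `a₀` and a flow box `e ∋ g a₀` determine a unique
continuous lift `G : A → F.GermSpace` of `g` with `G a₀` the germ of `h_e` — a continuous
family of germs of local first integrals at the points `g a`, compatible along `A` ("the
holonomy of `F` along `g` is trivial"; Mathlib's `IsCoveringMap.existsUnique_continuousMap_lifts`,
Hatcher Prop. 1.33). This is the input of the Reeb stability theorem and of Novikov's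
vanishing cycle arguments (Camacho–Lins Neto, Ch. IV §2–§4, Ch. VII).
[cite: HatcherAT2002, Prop. 1.33] -/
theorem existsUnique_lift_of_simplyConnectedSpace {A : Type*} [TopologicalSpace A]
    [SimplyConnectedSpace A] [LocallyPathConnectedSpace A] (g : C(A, F.LeafSpace)) (a₀ : A)
    (he : e ∈ F.atlas) (ha₀ : ofLeafSpace (g a₀) ∈ e.source) :
    ∃! G : C(A, F.GermSpace), G a₀ = GermSpace.ofHeight F he (g a₀) ha₀ ∧ GermSpace.proj ∘ G = g :=
  (F.isCoveringMap_proj).existsUnique_continuousMap_lifts g a₀ _ rfl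

/-- **A continuous family of germs is locally given by one section.** For a continuous map
`G : A → F.GermSpace` (e.g. a lift of a leaf map), a point `a` and a flow box `e` of the atlas
around the base point of `G a`, there are a homeomorphism germ `φ` at the height `t` of that
base point and a neighbourhood `U` of `a` on which the base points of `G` stay on the plaque
of `e` at height `t` and `G a'` is the germ of the *same* local first integral `φ ∘ h_e`
(read in the local product structure of the germ covering over that plaque: the second
component is locally constant). [folklore] -/
theorem exists_nhds_forall_eq_germSection {A : Type*} [TopologicalSpace A] (G : C(A, F.GermSpace))
    (a : A) (he : e ∈ F.atlas) (ha : ofLeafSpace (G a).pt ∈ e.source) :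
    ∃ (φ : ℝ → ℝ) (hφ : IsHomeoGermAt φ (e (ofLeafSpace (G a).pt)).2), ∃ U ∈ 𝓝 a,
      ∀ a' ∈ U, ∃ _ : ofLeafSpace (G a').pt ∈ plaque e (e (ofLeafSpace (G a).pt)).2,
        G a' = F.germSection he _ hφ (e (ofLeafSpace (G a').pt)).1 := by
  set t : ℝ := (e (ofLeafSpace (G a).pt)).2 with ht
  set O : Set F.GermSpace := GermSpace.proj ⁻¹' (ofLeafSpace ⁻¹' plaque e t) with hOdef
  have hO : IsOpen O := F.isOpen_proj_preimage_plaque he t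
  have haO : G a ∈ O := (mem_plaque_self ha : ofLeafSpace (G a).pt ∈ plaque e t)
  set T := F.trivialization he t with hT
  set Φ₀ : HomeoGerm t := (T ⟨G a, haO⟩).2 with hΦ₀
  obtain ⟨φ, hφ, hφe⟩ := Φ₀.2
  -- the parameters whose germ reads `Φ₀` through `e`
  let V : Set A := G ⁻¹' O
  have hV : IsOpen V := hO.preimage G.continuous
  let κ : V → HomeoGerm t := fun v ↦ (T ⟨G v, v.2⟩).2
  have hκ : Continuous κ :=
    continuous_snd.comp (T.continuous.comp ((G.continuous.comp continuous_subtype_val).subtype_mk _))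
  have hWo : IsOpen (κ ⁻¹' {Φ₀}) := (isOpen_discrete _).preimage hκ
  refine ⟨φ, hφ, Subtype.val '' (κ ⁻¹' {Φ₀}), ?_, ?_⟩
  · exact (hV.isOpenMap_subtype_val _ hWo).mem_nhds ⟨⟨a, haO⟩, rfl, rfl⟩
  · rintro a' ⟨⟨a', ha'O⟩, hκa', rfl⟩
    have ha'P : ofLeafSpace (G a').pt ∈ plaque e t := ha'O
    refine ⟨ha'P, ?_⟩
    -- `G a' = T.symm (T (G a')) = T.symm (⟨pt, _⟩, Φ₀) = germSection he t hφ _`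
    have h₁ : (T.symm (T ⟨G a', ha'O⟩) : F.GermSpace) = G a' := by
      rw [T.symm_apply_apply]
    have h₂ : T ⟨G a', ha'O⟩ = (⟨(G a').pt, ha'P⟩, HomeoGerm.mk φ hφ) := by
      refine Prod.ext rfl ?_
      rw [show (T ⟨G a', ha'O⟩).2 = Φ₀ from hκa']
      exact Subtype.ext hφe
    rw [← h₁, h₂, hT, F.trivialization_symm_apply he t]
    exact F.coe_trivInvFun_mk he t hφ ⟨(G a').pt, ha'P⟩

end Holonomy

end Foliation

end Literature.Topology.FourManifolds
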